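import Summits.QuantumFields.YangMills.Theorems.ColdStartUniversalityLatticeLangevinWilsonEnergyTools
import HarnessLib

/-!
# Route `ColdStartUniversality` (fixed-cut-off `L²(μ_{β'})` package): APPROXIMATION IN ENERGY of a continuous observable by
# `C³` cylinder functions — the core step of «generator-form Poincaré ⇒ `L²` decay» WITHOUT smoothing hypothesis

Helper file (seat `ym-line-csu-p1`, g18; `--supports stmt-QuantumFields-27363`), sequel of `…WilsonEnergyTools`.  For the SU(2) SZZ
dynamics at `(L, β')`, `μ = μ_{β'}`, `Q_h(w) = ∫ w² dμ − ∫ w κ_h w dμ = h 𝓔_h(w)`.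

* `sq_integral_sub_transition_near_le` — `∫ (G − κ⁰_sR)² dμ_0 ≤ 2 Q⁰_s(G) + 2δ²` for `|R − G| ≤ δ` (`κ⁰` the `β' = 0` kernels).
* `dirichletScale_transition_near_sub_le` — `Q⁰_h(κ⁰_sR − G) ≤ (h/s) δ² + 2 Q⁰_h(G − κ⁰_sG)`.
* ★★ `exists_cylinder_energy_approx` — if `𝓔_h(G) ≤ E` for all `h > 0` (`G` continuous), then for every `ε ∈ (0, 1]` there is
  a `C³` compactly supported `f` on the ambient link-coordinate space with

    `∫ (G − f∘coords)² dμ_{β'} ≤ A ε`   and   `𝓔_h(f∘coords − G) ≤ A ε` for all small `h > 0`,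

  `A` independent of `ε`.  Construction: `f∘coords = κ⁰_s R`, `R` a ridge function `εs`-close to `G`
  (`exists_ridge_near_and_cylinder_transition`), `s = min(s₀, ε)`; energies are moved between `β'` and `0` by
  `exists_dirichletScale_le_mul_beta_zero`, and `𝓔⁰_h(G − κ⁰_sG) ≤ 2ε` at small scales (`exists_energy_bound_beta_zero`).
  With the tree's generator-form inequality on `C³` cylinders this closes the core / essential-self-adjointness gap of
  Bakry–Gentil–Ledoux §3.2 for THIS diffusion without any PDE input (sequel `…WilsonGeneratorPoincare`).

THEOREMS ONLY, no definition, no sorry.  HONEST FRAMING: RECORD-rung R3 plumbing at FIXED cut-off; nothing K-uniform is proved;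
no crux, rung or summit statement is proved; the Yang–Mills mass gap is NOT proved.
-/

set_option autoImplicit false

noncomputable section

namespace Summit.QuantumFields.YangMills.Theorems.ColdStartUniversality

open MeasureTheory ProbabilityTheory Filter Set Topology
open scoped BigOperators NNReal ENNReal
open Literature.Probability.Process Literature.MathematicalPhysics.QuantumFieldTheory
open Literature.MathematicalPhysics.QuantumLattice (fundamentalRep fundamentalLatticeRep continuous_fundamentalRep)

variable {L : ℕ} [NeZero L]

/-! ## Approximation in energy by `C³` cylinder functions -/

/-- **`L²` distance between `G` and a smoothed approximant**: for continuous `G, R` with `|R − G| ≤ δ` and any realising kernel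
family `κ⁰` (`β' = 0`), `∫ (G − κ⁰_sR)² dμ_0 ≤ 2 Q⁰_s(G) + 2δ²` (`‖G − κ⁰_sG‖² ≤ Q⁰_s(G)` and `|κ⁰_s(G − R)| ≤ δ`). [folklore] -/
theorem sq_integral_sub_transition_near_le (L : ℕ) [NeZero L]
    (κ₀ : ℝ≥0 → Kernel (GaugeConfig 3 L (Matrix.specialUnitaryGroup (Fin 2) ℂ))
      (GaugeConfig 3 L (Matrix.specialUnitaryGroup (Fin 2) ℂ))) [∀ t, IsMarkovKernel (κ₀ t)]
    (hreal₀ : ∀ (t : ℝ≥0) (x : GaugeConfig 3 L (Matrix.specialUnitaryGroup (Fin 2) ℂ))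
        (Ω : Type) [MeasurableSpace Ω] (P : Measure Ω) [IsProbabilityMeasure P]
        (W : ℝ≥0 → Ω → (Edge 3 L × NoiseIdx 2 → ℝ)) (hW : IsFlatBrownian W P)
        (U : ℝ≥0 → Ω → GaugeConfig 3 L (Matrix.specialUnitaryGroup (Fin 2) ℂ)),
        (∀ ω, U 0 ω = x) →
        (latticeLangevinDynamics (fundamentalLatticeRep 2) 0).IsSolution (fundamentalRep (Fin 2))
          hW.natFiltration P W U →
        κ₀ t x = P.map (U t))
    {G R : GaugeConfig 3 L (Matrix.specialUnitaryGroup (Fin 2) ℂ) → ℝ} (hG : Continuous G) (hR : Continuous R)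
    {δ : ℝ} (hδ : ∀ x, |R x - G x| ≤ δ) (s : ℝ≥0) :
    ∫ x, (G x - ∫ y, R y ∂(κ₀ s x)) ^ 2 ∂(wilsonMeasure (d := 3) (L := L) (fundamentalRep (Fin 2)) 0) ≤
      2 * ((∫ x, G x * G x ∂(wilsonMeasure (d := 3) (L := L) (fundamentalRep (Fin 2)) 0)) -
        ∫ x, G x * (∫ y, G y ∂(κ₀ s x)) ∂(wilsonMeasure (d := 3) (L := L) (fundamentalRep (Fin 2)) 0)) + 2 * δ ^ 2 := by
  classical
  haveI := secondCountableTopology_su2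
  haveI := borelSpace_config L
  set μ₀ : Measure (GaugeConfig 3 L (Matrix.specialUnitaryGroup (Fin 2) ℂ)) :=
    wilsonMeasure (d := 3) (L := L) (fundamentalRep (Fin 2)) 0 with hμ₀
  haveI : IsProbabilityMeasure μ₀ :=
    isProbabilityMeasure_wilsonMeasure (d := 3) (L := L) (fundamentalRep (Fin 2)) (continuous_fundamentalRep (Fin 2)) 0
  have hint : ∀ {w : GaugeConfig 3 L (Matrix.specialUnitaryGroup (Fin 2) ℂ) → ℝ}, Continuous w →
      ∀ x, Integrable w (κ₀ s x) := by
    intro w hw x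
    obtain ⟨M', -, hM'⟩ := exists_abs_le_of_continuous hw
    exact Integrable.of_bound hw.aestronglyMeasurable M' (Eventually.of_forall fun z => by rw [Real.norm_eq_abs]; exact hM' z)
  have hKGc : Continuous fun x => ∫ y, G y ∂(κ₀ s x) := continuous_integral_transitionKernel L 0 κ₀ hreal₀ s hG
  have hKRc : Continuous fun x => ∫ y, R y ∂(κ₀ s x) := continuous_integral_transitionKernel L 0 κ₀ hreal₀ s hR
  have hc1 : Continuous fun x => G x - ∫ y, G y ∂(κ₀ s x) := hG.sub hKGc
  have hc2 : Continuous fun x => (∫ y, G y ∂(κ₀ s x)) - ∫ y, R y ∂(κ₀ s x) := hKGc.sub hKRc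
  have e1 : ∀ x, (G x - ∫ y, G y ∂(κ₀ s x)) + ((∫ y, G y ∂(κ₀ s x)) - ∫ y, R y ∂(κ₀ s x)) = G x - ∫ y, R y ∂(κ₀ s x) :=
    fun x => by ring
  have hstep2 := sq_integral_add_le (ν := μ₀) hc1 hc2 one_pos
  simp_rw [e1] at hstep2
  have e2 : ((1 : ℝ) + 1) = 2 := by norm_num
  have e3 : ((1 : ℝ) + 1⁻¹) = 2 := by norm_num
  rw [e2, e3] at hstep2
  have hstep3 := sq_integral_sub_transition_le L 0 κ₀ hreal₀ s hG
  -- `|κ⁰_s(G − R)| ≤ δ` pointwise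
  have hδpt : ∀ x, ((∫ y, G y ∂(κ₀ s x)) - ∫ y, R y ∂(κ₀ s x)) ^ 2 ≤ δ ^ 2 := by
    intro x
    have h1 : |(∫ y, G y ∂(κ₀ s x)) - ∫ y, R y ∂(κ₀ s x)| ≤ δ := by
      rw [← integral_sub (hint hG x) (hint hR x)]
      refine (abs_integral_le_integral_abs).trans ?_
      have h2 : ∫ y, |G y - R y| ∂(κ₀ s x) ≤ ∫ _y, δ ∂(κ₀ s x) :=
        integral_mono (hint (hG.sub hR).abs x) (integrable_const _) fun y => by
          dsimp only; rw [abs_sub_comm]; exact hδ y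
      rwa [integral_const, probReal_univ, one_smul] at h2
    calc ((∫ y, G y ∂(κ₀ s x)) - ∫ y, R y ∂(κ₀ s x)) ^ 2 = |(∫ y, G y ∂(κ₀ s x)) - ∫ y, R y ∂(κ₀ s x)| ^ 2 := (sq_abs _).symm
      _ ≤ δ ^ 2 := pow_le_pow_left₀ (abs_nonneg _) h1 2
  have hstep4 : ∫ x, ((∫ y, G y ∂(κ₀ s x)) - ∫ y, R y ∂(κ₀ s x)) ^ 2 ∂μ₀ ≤ δ ^ 2 := by
    have i1 : Integrable (fun x => ((∫ y, G y ∂(κ₀ s x)) - ∫ y, R y ∂(κ₀ s x)) ^ 2) μ₀ :=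
      integrable_of_continuous_of_compactSpace (hc2.pow 2) μ₀
    have i2 : Integrable (fun _ : GaugeConfig 3 L (Matrix.specialUnitaryGroup (Fin 2) ℂ) => δ ^ 2) μ₀ := integrable_const _
    have h1 := integral_mono i1 i2 fun x => hδpt x
    rwa [integral_const, probReal_univ, one_smul] at h1
  linarith [hstep2, hstep3, hstep4]

/-- **Energy of a smoothed approximant minus `G` at `β' = 0`**: for continuous `G, R` with `|R − G| ≤ δ`, `s > 0` and every `h`,
`Q⁰_h(κ⁰_sR − G) ≤ (h/s) δ² + 2 Q⁰_h(G − κ⁰_sG)` — seminorm inequality for `κ⁰_s(R − G) + (κ⁰_sG − G)`, the smoothing bound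
`Q⁰_h(κ⁰_s(R − G)) ≤ (h/2s) Var(R − G) ≤ (h/2s) δ²`, and evenness of the form. [folklore] -/
theorem dirichletScale_transition_near_sub_le (L : ℕ) [NeZero L]
    (κ₀ : ℝ≥0 → Kernel (GaugeConfig 3 L (Matrix.specialUnitaryGroup (Fin 2) ℂ))
      (GaugeConfig 3 L (Matrix.specialUnitaryGroup (Fin 2) ℂ))) [∀ t, IsMarkovKernel (κ₀ t)]
    (hreal₀ : ∀ (t : ℝ≥0) (x : GaugeConfig 3 L (Matrix.specialUnitaryGroup (Fin 2) ℂ))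
        (Ω : Type) [MeasurableSpace Ω] (P : Measure Ω) [IsProbabilityMeasure P]
        (W : ℝ≥0 → Ω → (Edge 3 L × NoiseIdx 2 → ℝ)) (hW : IsFlatBrownian W P)
        (U : ℝ≥0 → Ω → GaugeConfig 3 L (Matrix.specialUnitaryGroup (Fin 2) ℂ)),
        (∀ ω, U 0 ω = x) →
        (latticeLangevinDynamics (fundamentalLatticeRep 2) 0).IsSolution (fundamentalRep (Fin 2))
          hW.natFiltration P W U →
        κ₀ t x = P.map (U t))
    {G R : GaugeConfig 3 L (Matrix.specialUnitaryGroup (Fin 2) ℂ) → ℝ} (hG : Continuous G) (hR : Continuous R)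
    {δ : ℝ} (hδ : ∀ x, |R x - G x| ≤ δ) {s : ℝ≥0} (hs : 0 < s) (h : ℝ≥0) :
    (∫ x, ((∫ y, R y ∂(κ₀ s x)) - G x) * ((∫ y, R y ∂(κ₀ s x)) - G x)
        ∂(wilsonMeasure (d := 3) (L := L) (fundamentalRep (Fin 2)) 0)) -
      ∫ x, ((∫ y, R y ∂(κ₀ s x)) - G x) * (∫ y, ((∫ z, R z ∂(κ₀ s y)) - G y) ∂(κ₀ h x))
        ∂(wilsonMeasure (d := 3) (L := L) (fundamentalRep (Fin 2)) 0) ≤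
      (h : ℝ) / s * δ ^ 2 +
        2 * ((∫ x, (G x - ∫ y, G y ∂(κ₀ s x)) * (G x - ∫ y, G y ∂(κ₀ s x))
            ∂(wilsonMeasure (d := 3) (L := L) (fundamentalRep (Fin 2)) 0)) -
          ∫ x, (G x - ∫ y, G y ∂(κ₀ s x)) * (∫ y, (G y - ∫ z, G z ∂(κ₀ s y)) ∂(κ₀ h x))
            ∂(wilsonMeasure (d := 3) (L := L) (fundamentalRep (Fin 2)) 0)) := by
  classical
  haveI := secondCountableTopology_su2
  haveI := borelSpace_config L
  set μ₀ : Measure (GaugeConfig 3 L (Matrix.specialUnitaryGroup (Fin 2) ℂ)) :=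
    wilsonMeasure (d := 3) (L := L) (fundamentalRep (Fin 2)) 0 with hμ₀
  haveI : IsProbabilityMeasure μ₀ :=
    isProbabilityMeasure_wilsonMeasure (d := 3) (L := L) (fundamentalRep (Fin 2)) (continuous_fundamentalRep (Fin 2)) 0
  have hint : ∀ {w : GaugeConfig 3 L (Matrix.specialUnitaryGroup (Fin 2) ℂ) → ℝ}, Continuous w →
      ∀ x, Integrable w (κ₀ s x) := by
    intro w hw x
    obtain ⟨M', -, hM'⟩ := exists_abs_le_of_continuous hw
    exact Integrable.of_bound hw.aestronglyMeasurable M' (Eventually.of_forall fun z => by rw [Real.norm_eq_abs]; exact hM' z)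
  have hRGc : Continuous fun y => R y - G y := hR.sub hG
  set u : GaugeConfig 3 L (Matrix.specialUnitaryGroup (Fin 2) ℂ) → ℝ := fun x => ∫ y, (R y - G y) ∂(κ₀ s x) with hu
  set v : GaugeConfig 3 L (Matrix.specialUnitaryGroup (Fin 2) ℂ) → ℝ := fun x => (∫ y, G y ∂(κ₀ s x)) - G x with hv
  have hKGc : Continuous fun x => ∫ y, G y ∂(κ₀ s x) := continuous_integral_transitionKernel L 0 κ₀ hreal₀ s hG
  have huc : Continuous u := continuous_integral_transitionKernel L 0 κ₀ hreal₀ s hRGc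
  have hvc : Continuous v := hKGc.sub hG
  have hsplit : ∀ x, (∫ y, R y ∂(κ₀ s x)) - G x = u x + v x := by
    intro x; simp only [hu, hv]; rw [integral_sub (hint hR x) (hint hG x)]; ring
  simp_rw [hsplit]
  have hadd := dirichletScale_add_le L 0 κ₀ hreal₀ h huc hvc one_pos
  have hsR : (0 : ℝ) < s := by exact_mod_cast hs
  -- `Q⁰_h(u) ≤ (h/2s) δ²`
  have hQu : (∫ x, u x * u x ∂μ₀) - ∫ x, u x * (∫ y, u y ∂(κ₀ h x)) ∂μ₀ ≤ (h : ℝ) / (2 * s) * δ ^ 2 := by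
    have h1 := dirichletScale_transition_le_var L 0 κ₀ hreal₀ hs h hRGc
    have h2 := variance_le_sq_integral (L := L) 0 hRGc
    have h3 : ∫ x, (R x - G x) ^ 2 ∂μ₀ ≤ δ ^ 2 := by
      have i1 : Integrable (fun x => (R x - G x) ^ 2) μ₀ := integrable_of_continuous_of_compactSpace (hRGc.pow 2) μ₀
      have i2 : Integrable (fun _ : GaugeConfig 3 L (Matrix.specialUnitaryGroup (Fin 2) ℂ) => δ ^ 2) μ₀ := integrable_const _
      have h4 := integral_mono i1 i2 fun x => by
        show (R x - G x) ^ 2 ≤ δ ^ 2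
        calc (R x - G x) ^ 2 = |R x - G x| ^ 2 := (sq_abs _).symm
          _ ≤ δ ^ 2 := pow_le_pow_left₀ (abs_nonneg _) (hδ x) 2
      rwa [integral_const, probReal_univ, one_smul] at h4
    exact h1.trans (mul_le_mul_of_nonneg_left (h2.trans h3) (by positivity))
  -- `Q⁰_h(v) = Q⁰_h(G − κ⁰_sG)`
  have hQv : (∫ x, v x * v x ∂μ₀) - ∫ x, v x * (∫ y, v y ∂(κ₀ h x)) ∂μ₀ =
      (∫ x, (G x - ∫ y, G y ∂(κ₀ s x)) * (G x - ∫ y, G y ∂(κ₀ s x)) ∂μ₀) -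
        ∫ x, (G x - ∫ y, G y ∂(κ₀ s x)) * (∫ y, (G y - ∫ z, G z ∂(κ₀ s y)) ∂(κ₀ h x)) ∂μ₀ := by
    simp only [hv]
    exact dirichletScale_sub_comm (κh := κ₀ h) (ν := μ₀) hKGc hG
  have e : (h : ℝ) / s * δ ^ 2 = 2 * ((h : ℝ) / (2 * s) * δ ^ 2) := by
    rw [mul_comm (2 : ℝ) (s : ℝ), ← div_div]; ring
  rw [e, ← hQv]
  have e2 : ((1 : ℝ) + 1) = 2 := by norm_num
  have e3 : ((1 : ℝ) + 1⁻¹) = 2 := by norm_num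
  rw [e2, e3] at hadd
  linarith [hadd, hQu]

/-- ★★ **Approximation in energy.**  Let `G` be continuous with `𝓔_h(G) ≤ E` for all `h > 0` (semigroup Dirichlet forms of the
SZZ dynamics at `(L, β')`, any realising kernel family).  Then there is `A ≥ 0` such that for every `ε ∈ (0, 1]` some `C³`
compactly supported `f` on the ambient link-coordinate space satisfies `∫ (G − f∘coords)² dμ_{β'} ≤ A ε` and
`𝓔_h(f∘coords − G) ≤ A ε` for all small `h > 0`.  Construction: `f∘coords = κ⁰_s R` (`exists_ridge_near_and_cylinder_transition`)
with `s = min(s₀, ε)` and `R` a ridge function `εs`-close to `G`; `sq_integral_sub_transition_near_le`,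
`dirichletScale_transition_near_sub_le`, `exists_energy_bound_beta_zero`, and the comparison `exists_dirichletScale_le_mul_beta_zero`.
This replaces the smoothing hypothesis `(S)` of `…WilsonSemigroupPoincareSmoothing`. [cite: BakryGentilLedoux2014, §3.1.8 and Prop. 3.1.6] -/
theorem exists_cylinder_energy_approx (L : ℕ) [NeZero L] (β' : ℝ)
    (κ : ℝ≥0 → Kernel (GaugeConfig 3 L (Matrix.specialUnitaryGroup (Fin 2) ℂ))
      (GaugeConfig 3 L (Matrix.specialUnitaryGroup (Fin 2) ℂ))) [∀ t, IsMarkovKernel (κ t)]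
    (hreal : ∀ (t : ℝ≥0) (x : GaugeConfig 3 L (Matrix.specialUnitaryGroup (Fin 2) ℂ))
        (Ω : Type) [MeasurableSpace Ω] (P : Measure Ω) [IsProbabilityMeasure P]
        (W : ℝ≥0 → Ω → (Edge 3 L × NoiseIdx 2 → ℝ)) (hW : IsFlatBrownian W P)
        (U : ℝ≥0 → Ω → GaugeConfig 3 L (Matrix.specialUnitaryGroup (Fin 2) ℂ)),
        (∀ ω, U 0 ω = x) →
        (latticeLangevinDynamics (fundamentalLatticeRep 2) β').IsSolution (fundamentalRep (Fin 2))
          hW.natFiltration P W U →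
        κ t x = P.map (U t))
    {G : GaugeConfig 3 L (Matrix.specialUnitaryGroup (Fin 2) ℂ) → ℝ} (hG : Continuous G) {E : ℝ}
    (hE : ∀ h : ℝ≥0, 0 < h →
      (h : ℝ)⁻¹ * ((∫ x, G x * G x ∂(wilsonMeasure (d := 3) (L := L) (fundamentalRep (Fin 2)) β')) -
        ∫ x, G x * (∫ y, G y ∂(κ h x)) ∂(wilsonMeasure (d := 3) (L := L) (fundamentalRep (Fin 2)) β')) ≤ E) :
    ∃ A : ℝ, 0 ≤ A ∧ ∀ ε : ℝ, 0 < ε → ε ≤ 1 →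
      ∃ f : (Edge 3 L × Fin 2 × Fin 2 × Bool → ℝ) → ℝ, ContDiff ℝ 3 f ∧ HasCompactSupport f ∧
        let coords : GaugeConfig 3 L (Matrix.specialUnitaryGroup (Fin 2) ℂ) → (Edge 3 L × Fin 2 × Fin 2 × Bool → ℝ) :=
          fun V q => (fun z : ℂ => if q.2.2.2 then z.im else z.re)
            ((fundamentalRep (Fin 2) (V q.1) : Matrix (Fin 2) (Fin 2) ℂ) q.2.1 q.2.2.1)
        (∫ x, (G x - f (coords x)) ^ 2 ∂(wilsonMeasure (d := 3) (L := L) (fundamentalRep (Fin 2)) β') ≤ A * ε) ∧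
        ∃ h₀ : ℝ≥0, 0 < h₀ ∧ ∀ h : ℝ≥0, 0 < h → h ≤ h₀ →
          (h : ℝ)⁻¹ * ((∫ x, (f (coords x) - G x) * (f (coords x) - G x)
              ∂(wilsonMeasure (d := 3) (L := L) (fundamentalRep (Fin 2)) β')) -
            ∫ x, (f (coords x) - G x) * (∫ y, (f (coords y) - G y) ∂(κ h x))
              ∂(wilsonMeasure (d := 3) (L := L) (fundamentalRep (Fin 2)) β')) ≤ A * ε := by
  classical
  haveI := secondCountableTopology_su2
  haveI := borelSpace_config L
  set μ : Measure (GaugeConfig 3 L (Matrix.specialUnitaryGroup (Fin 2) ℂ)) :=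
    wilsonMeasure (d := 3) (L := L) (fundamentalRep (Fin 2)) β' with hμ
  set μ₀ : Measure (GaugeConfig 3 L (Matrix.specialUnitaryGroup (Fin 2) ℂ)) :=
    wilsonMeasure (d := 3) (L := L) (fundamentalRep (Fin 2)) 0 with hμ₀
  haveI : IsProbabilityMeasure μ :=
    isProbabilityMeasure_wilsonMeasure (d := 3) (L := L) (fundamentalRep (Fin 2)) (continuous_fundamentalRep (Fin 2)) β'
  haveI : IsProbabilityMeasure μ₀ :=
    isProbabilityMeasure_wilsonMeasure (d := 3) (L := L) (fundamentalRep (Fin 2)) (continuous_fundamentalRep (Fin 2)) 0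
  -- the `β' = 0` kernels, the comparison constants, the `β' = 0` energy bound
  obtain ⟨κ₀, hκ₀M, -, hreal₀⟩ := exists_transitionKernel L 0
  haveI := hκ₀M
  obtain ⟨K, C, hC, hcmp⟩ := exists_dirichletScale_le_mul_beta_zero L β'
  obtain ⟨a, ha, hμle, -⟩ := wilsonMeasure_le_smul_pi_haar_and (L := L) β'
  rw [← wilsonMeasure_zero_eq_pi (L := L)] at hμle
  obtain ⟨E₀, hE₀0, hE₀, hsmall⟩ := exists_energy_bound_beta_zero L β' κ hreal κ₀ hreal₀ hG hE
  refine ⟨max (5 * C * Real.exp |K|) (2 * a * (1 + E₀)), le_max_of_le_left (by positivity), fun ε hε hε1 => ?_⟩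
  obtain ⟨s₀, hs₀, h₀, hh₀, hsm⟩ := hsmall ε hε
  -- the smoothing time `s = min(s₀, ε)` and the ridge tolerance `δ = ε s`
  set s : ℝ≥0 := min s₀ ⟨ε, hε.le⟩ with hsdef
  have hs : 0 < s := lt_min hs₀ (by exact_mod_cast hε)
  have hss₀ : s ≤ s₀ := min_le_left _ _
  have hsR : (0 : ℝ) < s := by exact_mod_cast hs
  have hsε : (s : ℝ) ≤ ε := by
    have : s ≤ ⟨ε, hε.le⟩ := min_le_right _ _
    exact_mod_cast this
  have hs1 : (s : ℝ) ≤ 1 := hsε.trans hε1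
  have hεs2 : (ε * s) ^ 2 ≤ ε * (s : ℝ) := by
    have h1 : ε * (s : ℝ) ≤ 1 := by nlinarith
    nlinarith [h1, show (0 : ℝ) ≤ ε * s by positivity]
  obtain ⟨R, hRc, hRG, f, hf, hfc, hfeq⟩ :=
    exists_ridge_near_and_cylinder_transition L κ₀ hreal₀ hG (show (0 : ℝ) < ε * s by positivity) s
  have hδ : ∀ x, |R x - G x| ≤ ε * s := fun x => (hRG x).le
  refine ⟨f, hf, hfc, ?_⟩
  intro coords
  have hfx : ∀ x, f (coords x) = ∫ y, R y ∂(κ₀ s x) := fun x => hfeq x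
  have hKRc : Continuous fun x => ∫ y, R y ∂(κ₀ s x) := continuous_integral_transitionKernel L 0 κ₀ hreal₀ s hRc
  refine ⟨?_, min h₀ 1, lt_min hh₀ one_pos, fun h hh hhle => ?_⟩
  · ------------------------------------------------------------------ the `L²` estimate
    simp_rw [hfx]
    have h1 := sq_integral_sub_transition_near_le L κ₀ hreal₀ hG hRc hδ s
    have h2 : ∫ x, (G x - ∫ y, R y ∂(κ₀ s x)) ^ 2 ∂μ ≤ a * ∫ x, (G x - ∫ y, R y ∂(κ₀ s x)) ^ 2 ∂μ₀ :=
      integral_le_mul_integral_of_le_smul ha.le hμle ((hG.sub hKRc).pow 2) fun x => sq_nonneg _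
    have h3 : (∫ x, G x * G x ∂μ₀) - ∫ x, G x * (∫ y, G y ∂(κ₀ s x)) ∂μ₀ ≤ ε * E₀ := by
      have h4 := hE₀ s hs
      rw [inv_mul_le_iff₀ hsR] at h4
      exact h4.trans (mul_le_mul_of_nonneg_right hsε hE₀0)
    have h5 : (ε * s) ^ 2 ≤ ε := hεs2.trans (by nlinarith)
    calc ∫ x, (G x - ∫ y, R y ∂(κ₀ s x)) ^ 2 ∂μ
        ≤ a * (2 * (ε * E₀) + 2 * ε) := h2.trans (mul_le_mul_of_nonneg_left (h1.trans (by linarith)) ha.le)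
      _ = 2 * a * (1 + E₀) * ε := by ring
      _ ≤ max (5 * C * Real.exp |K|) (2 * a * (1 + E₀)) * ε := mul_le_mul_of_nonneg_right (le_max_right _ _) hε.le
  · ------------------------------------------------------------------ the energy estimate
    have hhh₀ : h ≤ h₀ := hhle.trans (min_le_left _ _)
    have hh1 : h ≤ 1 := hhle.trans (min_le_right _ _)
    have hhR : (0 : ℝ) < h := by exact_mod_cast hh
    simp_rw [hfx]
    have hw : Continuous fun x => (∫ y, R y ∂(κ₀ s x)) - G x := hKRc.sub hG
    have h1 := dirichletScale_transition_near_sub_le L κ₀ hreal₀ hG hRc hδ hs h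
    have h2 := hsm s hs hss₀ h hh hhh₀
    rw [inv_mul_le_iff₀ hhR] at h2
    have h3 := (hcmp κ hreal κ₀ hreal₀ (fun x => (∫ y, R y ∂(κ₀ s x)) - G x) hw h).1
    have hexp : Real.exp (K * h) ≤ Real.exp |K| := by
      refine Real.exp_le_exp.2 ?_
      have h1' : (h : ℝ) ≤ 1 := by exact_mod_cast hh1
      calc K * h ≤ |K| * h := mul_le_mul_of_nonneg_right (le_abs_self K) hhR.le
        _ ≤ |K| * 1 := mul_le_mul_of_nonneg_left h1' (abs_nonneg K)
        _ = |K| := mul_one _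
    have h4 : (h : ℝ) / s * (ε * s) ^ 2 ≤ (h : ℝ) * ε := by
      rw [div_mul_eq_mul_div, div_le_iff₀ hsR]
      have : ε ^ 2 * (s : ℝ) ≤ ε := by nlinarith
      nlinarith [this, hhR.le, hsR.le]
    -- `Q⁰_h(κ⁰_sR − G) ≤ 5 ε h`
    have hQ0 : (∫ x, ((∫ y, R y ∂(κ₀ s x)) - G x) * ((∫ y, R y ∂(κ₀ s x)) - G x) ∂μ₀) -
        ∫ x, ((∫ y, R y ∂(κ₀ s x)) - G x) * (∫ y, ((∫ z, R z ∂(κ₀ s y)) - G y) ∂(κ₀ h x)) ∂μ₀ ≤ 5 * ε * h := by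
      refine h1.trans ?_
      nlinarith [h2, h4, hhR.le, hε.le]
    rw [inv_mul_le_iff₀ hhR]
    calc (∫ x, ((∫ y, R y ∂(κ₀ s x)) - G x) * ((∫ y, R y ∂(κ₀ s x)) - G x) ∂μ) -
          ∫ x, ((∫ y, R y ∂(κ₀ s x)) - G x) * (∫ y, ((∫ z, R z ∂(κ₀ s y)) - G y) ∂(κ h x)) ∂μ
        ≤ C * Real.exp (K * h) * (5 * ε * h) := h3.trans (mul_le_mul_of_nonneg_left hQ0 (by positivity))
      _ ≤ C * Real.exp |K| * (5 * ε * h) :=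
          mul_le_mul_of_nonneg_right (mul_le_mul_of_nonneg_left hexp hC.le) (by positivity)
      _ = (h : ℝ) * (5 * C * Real.exp |K| * ε) := by ring
      _ ≤ (h : ℝ) * (max (5 * C * Real.exp |K|) (2 * a * (1 + E₀)) * ε) :=
          mul_le_mul_of_nonneg_left (mul_le_mul_of_nonneg_right (le_max_left _ _) hε.le) hhR.le

end Summit.QuantumFields.YangMills.Theorems.ColdStartUniversality

end
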